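import Literature.NumberTheory.Automorphic.OrbitalMeasureQuotientOfPoint   -- ★ `OrbitalMeasureFamily.IsQuotientOf.atPoint_eq_quotientMeasure_map`, `out_conjClassesMk_eq_conj`
import HarnessLib

/-!
# Two `IsQuotientOf` families of the SAME Haar measure by the SAME centraliser data AGREE on the guard — at the classes and at the points
(Rogawski (1990) §1.7 p. 6, §4.3 (4.3.1) p. 43; Deitmar–Echterhoff (2014) Thm. 1.5.3)

Topic `NumberTheory/Automorphic`; namespace `Literature.NumberTheory.Automorphic`.  THEOREMS ONLY over accepted tree modules (no definition, no named
fact, no instance, no notation, no `sorry`); generic locally compact second countable Hausdorff group `G`, a right-invariant Radon measure `ν` on `G`,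
centraliser data `t : ∀ γ, Measure Z(γ)` and a guard `P : G → Prop`.

WHY.  ★ `OrbitalMeasureFamily.IsQuotientOf P ν t m` (★ `Rogawski1990/TransferFactsCanonical`) says that at every class `c` whose representative `out c`
satisfies `P`, `m c` IS the invariant quotient measure `dν ∕ d(t (out c))` (★ `quotientMeasure`); the witnesses `IsHaarMeasure (t (out c))`,
`IsInvInvariant (t (out c))` it packages are PROOFS, so the right-hand side does not depend on them.  Hence two families `m`, `m₀` that are BOTH the
quotient family of `ν` by `t` on the `P`-classes coincide there — on the class measures (`apply_eq_of_isQuotientOf`), on the measures READ AT A POINT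
(★ `OrbitalMeasureFamily.atPoint`, the class measure transported along the conjugator `conjOut γ`: `atPoint_eq_atPoint_of_isQuotientOf`), and, for a
conjugation-stable guard, at every `P`-point (`atPoint_eq_atPoint_of_isQuotientOf_of_forall_conj`).  No coherence of `t` under conjugation is needed
(contrast ★ `IsQuotientOf.atPoint_eq_quotientMeasure_of_forall_map_conj_eq`, which READS `t γ` at the point itself).

USE (cell `pub/hodgecm-mathlib`, crux H413 = stmt-HodgeConjecture-24833, GO-500 line LH5, pay-down of the closer stub `stub_S1finTFCovol`): the letter
★ `TamagawaSingularMembersFinTFCovol` reads its singular MEMBERS `mGs v` only through (Q-fin) = `IsQuotientOf (guard_v) νG_v (tGs v) (mGs v)`; two member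
families of the same partners `tGs` therefore agree wherever the letter reads them — the in-house organs O6 «κ-TRANSPORT» (LH5-p01) and O6′ «T′-TRANSPORT»
(★-to-be `Rogawski1990/TamagawaSingularTprimeTransport`, LH5-p04) are this file read through `localStableOrbitalIntegral` resp. `UnitaryGroup.IsNormalisedOff`.
HC_CM is proved only modulo the printed citations until rung 0 closes; this file is measure-theoretic bookkeeping and proves no printed statement.

* `OrbitalMeasureFamily.IsQuotientOf.apply_eq_of_isQuotientOf` — `m c = m₀ c` at every class `c` with `P (out c)`;
* `OrbitalMeasureFamily.IsQuotientOf.atPoint_eq_atPoint_of_isQuotientOf` — `m.atPoint γ = m₀.atPoint γ` whenever `P (out ⟦γ⟧)`;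
* `OrbitalMeasureFamily.IsQuotientOf.atPoint_eq_atPoint_of_isQuotientOf_of_forall_conj` — the same at every `γ` with `P γ`, for `P` conjugation-stable.

## References
* J. D. Rogawski, *Automorphic Representations of Unitary Groups in Three Variables*, Ann. of Math. Stud. 123 (1990), §1.7 p. 6, §4.3 (4.3.1) p. 43
  [Rogawski1990].
* A. Deitmar, S. Echterhoff, *Principles of Harmonic Analysis*, 2nd ed. (2014), Thm. 1.5.3 [DeitmarEchterhoff2014].
-/

set_option autoImplicit false

noncomputable section

open MeasureTheory Measure Set
open Literature.MeasureTheory.Group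

namespace Literature.NumberTheory.Automorphic

section Agree

variable {G : Type*} [Group G] [TopologicalSpace G] [IsTopologicalGroup G] [LocallyCompactSpace G]
  [SecondCountableTopology G] [T2Space G] [MeasurableSpace G] [BorelSpace G]
  [∀ γ : G, MeasurableSpace (G ⧸ Subgroup.centralizer ({γ} : Set G))]
  [∀ γ : G, BorelSpace (G ⧸ Subgroup.centralizer ({γ} : Set G))]
  {P : G → Prop} {ν : Measure G} [IsFiniteMeasureOnCompacts ν] [ν.IsMulRightInvariant]
  {t : ∀ γ : G, Measure (Subgroup.centralizer ({γ} : Set G))} {m m₀ : OrbitalMeasureFamily G}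

/-- **Two quotient families of `ν` by the same data `t` agree on the `P`-classes**: if `m` and `m₀` are both `IsQuotientOf P ν t`, then `m c = m₀ c` at
every class `c` with `P (out c)` — both are `quotientMeasure Z(out c) (t (out c)) ν`, whose instance witnesses are proof-irrelevant. «the orbital integrals
are defined using compatible measures on `H_{γ′}` and `G_γ`» — the measure on `Z∖G` is determined by the pair `(ν, t)`.
[cite: Rogawski1990, §4.3 (4.3.1) p. 43] [cite: DeitmarEchterhoff2014, Thm. 1.5.3] -/
theorem OrbitalMeasureFamily.IsQuotientOf.apply_eq_of_isQuotientOf (h : m.IsQuotientOf P ν t) (h₀ : m₀.IsQuotientOf P ν t)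
    (c : ConjClasses G) (hc : P (Quotient.out c)) : m c = m₀ c := by
  obtain ⟨_, _, h1⟩ := h c hc
  obtain ⟨_, _, h2⟩ := h₀ c hc
  exact h1.trans h2.symm

/-- **… hence they agree READ AT A POINT** (★ `OrbitalMeasureFamily.atPoint` transports the class measure `m ⟦γ⟧` along the conjugator `conjOut γ`):
`m.atPoint γ = m₀.atPoint γ` whenever `P (out ⟦γ⟧)`. [cite: Rogawski1990, §4.3 (4.3.1) p. 43] [cite: DeitmarEchterhoff2014, Thm. 1.5.3] -/
theorem OrbitalMeasureFamily.IsQuotientOf.atPoint_eq_atPoint_of_isQuotientOf (h : m.IsQuotientOf P ν t) (h₀ : m₀.IsQuotientOf P ν t)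
    (γ : G) (hc : P (Quotient.out (ConjClasses.mk γ))) : m.atPoint γ = m₀.atPoint γ := by
  unfold OrbitalMeasureFamily.atPoint
  rw [h.apply_eq_of_isQuotientOf h₀ (ConjClasses.mk γ) hc]

/-- **… and at every `P`-point when the guard `P` is conjugation-stable** (`P (out ⟦γ⟧)` from `P γ`: the representative is a conjugate of `γ`,
★ `out_conjClassesMk_eq_conj`). [cite: Rogawski1990, §1.7 p. 6; §4.3 (4.3.1) p. 43] [cite: DeitmarEchterhoff2014, Thm. 1.5.3] -/
theorem OrbitalMeasureFamily.IsQuotientOf.atPoint_eq_atPoint_of_isQuotientOf_of_forall_conj (h : m.IsQuotientOf P ν t)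
    (h₀ : m₀.IsQuotientOf P ν t) (hP : ∀ (γ₁ q : G), P γ₁ → P (q * γ₁ * q⁻¹)) (γ : G) (hγ : P γ) :
    m.atPoint γ = m₀.atPoint γ :=
  h.atPoint_eq_atPoint_of_isQuotientOf h₀ γ (by rw [out_conjClassesMk_eq_conj γ]; exact hP γ _ hγ)

end Agree

end Literature.NumberTheory.Automorphic

end
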